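import Literature.NumberTheory.LFunctions.DirichletMVTSharp
import HarnessLib

/-!
# Strong multiplicity one for the Selberg class: mean square of the prime-square polynomial

Layer 7 of the formalisation of K. Soundararajan, *Strong multiplicity one for the Selberg class*,
arXiv:math/0210299 (named fact
`Literature.NumberTheory.LFunctions.Soundararajan2004_strongMultiplicityOne_thinSet`). Pure proof
file (theorems only). The mean-value step of p. 2 ("Using now a familiar mean-value estimate of
Montgomery and Vaughan ([4], see Corollary 3) we see that `∫_T^{2T} |∑_p (a_F(p²) − a_G(p²)) p^{-1-2it}
log p g(2 log p/L)|² dt ≪ ∑_{p ≤ e^{L/2}} |a_F(p²) − a_G(p²)|² p^{-2}(T + p) log²p`"), with the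
tree's PROVED `(W + O(n))`-weighted mean value theorem
`Literature.NumberTheory.LFunctions.DirichletMVT.meanSquare_shift_le` (Montgomery–Vaughan 1974,
Cor. 3, weak constants) in place of the cited Corollary 3:

* `Soundararajan2004.meanSquare_two_mul_le` — `∫_T^{2T} |∑_{n ≤ X} a_n n^{-2it}|² ≤ ½∑ (5T + 20 + 65n)|a_n|²`;
* `Soundararajan2004.primeSq_meanSquare_le` — the prime-square polynomial with a bounded real weight:
  `∫_T^{2T} |∑_{p ≤ X} c(p²)(2 log p) w(p) p^{-1-2it}|² ≤ 2B² ∑_{p ≤ X} (5T + 20 + 65p) log²p |c(p²)|²/p²`.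

## References

* K. Soundararajan, arXiv:math/0210299, p. 2, (10a)–(10b). [Soundararajan2002]
* H. L. Montgomery, R. C. Vaughan, *Hilbert's inequality*, J. London Math. Soc. (2) 8 (1974),
  Corollary 3. [MontgomeryVaughan1974]
-/

noncomputable section

open Complex Filter Topology Set MeasureTheory intervalIntegral

namespace Literature.NumberTheory.LFunctions
namespace Soundararajan2004

/-- **Mean square of a Dirichlet polynomial in `p^{-2it}` over `[T, 2T]`** (the use of "a familiar
mean-value estimate of Montgomery and Vaughan" for (10a)–(10b) of the source): for any coefficients,
`∫_T^{2T} |∑_{n ≤ X} a_n n^{-2it}|² dt ≤ ½ ∑_{n ≤ X} (5T + 20 + 65 n) |a_n|²`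
(substitute `t ↦ 2t` and apply the tree's `(W + O(n))`-weighted mean value theorem
`Literature.NumberTheory.LFunctions.DirichletMVT.meanSquare_shift_le` on the window `[2T, 4T]`).
[cite: Soundararajan2002, (10a)] -/
theorem meanSquare_two_mul_le (a : ℕ → ℂ) (X : ℕ) {T : ℝ} (hT : 0 < T) :
    ∫ t in T..(2 * T), ‖∑ n ∈ Finset.Icc 1 X, a n * (n : ℂ) ^ (-(2 * (t : ℂ) * I))‖ ^ 2 ≤
      (1 / 2) * ∑ n ∈ Finset.Icc 1 X, (5 * T + 20 + 65 * n) * ‖a n‖ ^ 2 := by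
  set f : ℝ → ℝ := fun u ↦ ‖∑ n ∈ Finset.Icc 1 X, a n * (n : ℂ) ^ (-((u : ℂ) * I))‖ ^ 2 with hf
  have hsub : ∫ t in T..(2 * T), ‖∑ n ∈ Finset.Icc 1 X, a n * (n : ℂ) ^ (-(2 * (t : ℂ) * I))‖ ^ 2 =
      (1 / 2) * ∫ u in (2 * T)..(2 * (2 * T)), f u := by
    have h := intervalIntegral.integral_comp_mul_left f (c := 2) (a := T) (b := 2 * T) (by norm_num)
    -- `h : ∫ x in T..2T, f (2 * x) = 2⁻¹ • ∫ x in 2T..2(2T), f x`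
    have hf2 : ∀ t : ℝ, f (2 * t) = ‖∑ n ∈ Finset.Icc 1 X, a n * (n : ℂ) ^ (-(2 * (t : ℂ) * I))‖ ^ 2 := by
      intro t; simp only [hf]; push_cast; ring_nf
    simp_rw [hf2] at h
    rw [h, smul_eq_mul]; norm_num
  rw [hsub]
  have hmv := DirichletMVT.meanSquare_shift_le a X hT (3 * T)
  have h1 : 3 * T - T = 2 * T := by ring
  have h2 : 3 * T + T = 2 * (2 * T) := by ring
  rw [h1, h2] at hmv
  have : (0 : ℝ) ≤ 1 / 2 := by norm_num
  calc (1 / 2) * ∫ u in (2 * T)..(2 * (2 * T)), f u ≤ (1 / 2) * ∑ n ∈ Finset.Icc 1 X, (5 * T + 20 + 65 * n) * ‖a n‖ ^ 2 :=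
        mul_le_mul_of_nonneg_left hmv this
    _ = _ := rfl


/-- **(10a)/(10b), the prime-square polynomial**: for coefficients `c`, real weights `|w(p)| ≤ B`,
`∫_T^{2T} |∑_{p ≤ X} c(p²) (2 log p) w(p) p^{-1} p^{-2it}|² dt ≤ 2B² ∑_{p ≤ X} (5T + 20 + 65p) log²p |c(p²)|²/p²`,
i.e. `≪ T ∑_p |c(p²)|² log²p/p² + ∑_{p ≤ X} |c(p²)|² log²p/p` ("`≪ T + ∑_{p ≤ e^{L/2}} |a_F(p²) − a_G(p²)|² log²p/p`",
p. 2). [cite: Soundararajan2002, (10a)–(10b)] -/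
theorem primeSq_meanSquare_le (c : ℕ → ℂ) (w : ℕ → ℝ) {B : ℝ} (hw : ∀ p, |w p| ≤ B) (X : ℕ) {T : ℝ} (hT : 0 < T) :
    ∫ t in T..(2 * T), ‖∑ p ∈ (Finset.Icc 1 X).filter Nat.Prime,
        c (p ^ 2) * (2 * Real.log p) * w p / p * (p : ℂ) ^ (-(2 * (t : ℂ) * I))‖ ^ 2 ≤
      2 * B ^ 2 * ∑ p ∈ (Finset.Icc 1 X).filter Nat.Prime,
        (5 * T + 20 + 65 * p) * (Real.log p) ^ 2 * ‖c (p ^ 2)‖ ^ 2 / (p : ℝ) ^ 2 := by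
  classical
  set a : ℕ → ℂ := fun n ↦ if n.Prime then c (n ^ 2) * (2 * Real.log n) * w n / n else 0 with ha
  have hpoly : ∀ t : ℝ, ∑ p ∈ (Finset.Icc 1 X).filter Nat.Prime,
      c (p ^ 2) * (2 * Real.log p) * w p / p * (p : ℂ) ^ (-(2 * (t : ℂ) * I)) =
      ∑ n ∈ Finset.Icc 1 X, a n * (n : ℂ) ^ (-(2 * (t : ℂ) * I)) := by
    intro t
    rw [Finset.sum_filter]
    refine Finset.sum_congr rfl fun n _ ↦ ?_
    simp only [ha]
    split_ifs <;> simp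
  simp_rw [hpoly]
  refine (meanSquare_two_mul_le a X hT).trans ?_
  have hB : 0 ≤ B := (abs_nonneg _).trans (hw 2)
  have hterm : ∀ n ∈ Finset.Icc 1 X, (5 * T + 20 + 65 * n) * ‖a n‖ ^ 2 ≤
      if n.Prime then 4 * B ^ 2 * ((5 * T + 20 + 65 * n) * (Real.log n) ^ 2 * ‖c (n ^ 2)‖ ^ 2 / (n : ℝ) ^ 2) else 0 := by
    intro n hn
    simp only [ha]
    split_ifs with hp
    · have hn0 : (0 : ℝ) < n := by exact_mod_cast hp.pos
      have hlog : 0 ≤ Real.log n := Real.log_nonneg (by exact_mod_cast hp.one_lt.le)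
      rw [norm_div, norm_mul, norm_mul, Complex.norm_natCast, Complex.norm_real, Complex.norm_mul,
        Complex.norm_two, Complex.norm_real, Real.norm_of_nonneg hlog, Real.norm_eq_abs]
      have hcoef : 0 ≤ 5 * T + 20 + 65 * (n : ℝ) := by positivity
      have hw2 : |w n| ^ 2 ≤ B ^ 2 := pow_le_pow_left₀ (abs_nonneg _) (hw n) 2
      rw [div_pow, mul_pow, mul_pow]
      calc (5 * T + 20 + 65 * n) * (‖c (n ^ 2)‖ ^ 2 * (2 * Real.log n) ^ 2 * |w n| ^ 2 / (n : ℝ) ^ 2)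
          ≤ (5 * T + 20 + 65 * n) * (‖c (n ^ 2)‖ ^ 2 * (2 * Real.log n) ^ 2 * B ^ 2 / (n : ℝ) ^ 2) := by
            gcongr
        _ = 4 * B ^ 2 * ((5 * T + 20 + 65 * n) * Real.log n ^ 2 * ‖c (n ^ 2)‖ ^ 2 / (n : ℝ) ^ 2) := by ring
    · simp
  calc (1 / 2) * ∑ n ∈ Finset.Icc 1 X, (5 * T + 20 + 65 * n) * ‖a n‖ ^ 2
      ≤ (1 / 2) * ∑ n ∈ Finset.Icc 1 X, (if n.Prime then
          4 * B ^ 2 * ((5 * T + 20 + 65 * n) * (Real.log n) ^ 2 * ‖c (n ^ 2)‖ ^ 2 / (n : ℝ) ^ 2) else 0) :=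
        mul_le_mul_of_nonneg_left (Finset.sum_le_sum hterm) (by norm_num)
    _ = 2 * B ^ 2 * ∑ p ∈ (Finset.Icc 1 X).filter Nat.Prime,
        (5 * T + 20 + 65 * p) * (Real.log p) ^ 2 * ‖c (p ^ 2)‖ ^ 2 / (p : ℝ) ^ 2 := by
        rw [← Finset.sum_filter, Finset.mul_sum, Finset.mul_sum]
        refine Finset.sum_congr rfl fun n _ ↦ by ring

end Soundararajan2004
end Literature.NumberTheory.LFunctions

end
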